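import Summits.QuantumFields.YangMills.Theorems.UnitScaleTiltProp7LineAvgRightInverse
import Literature.MathematicalPhysics.QuantumFieldTheory.BalabanImbrieJaffe1984to88.BIJ85AxialPropagator411
import HarnessLib

/-!
# Route `UnitScaleTilt`, crux K1 child «MinimiserStabilityRegPr» (stmt-QuantumFields-19200), registered stub `stub_prop7From14` (skeleton birth_v5
# 98cb23610ad7; leaf V3 «Prop 7 from a background (14)») — sub-lemma V3-C (linear core), corollary: **PROJECTION ONTO THE KERNEL OF THE
# STRAIGHT-LINE `k`-FOLD BLOCK AVERAGING WITH `k`-UNIFORM SUP / `ℓ¹` / `ℓ²` CONTROL BY THE AVERAGES** — the secant–tangent correction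
# `Y ↦ Y₀ = Y − H(Q_kY) ∈ ker Q_k`, `‖Y − Y₀‖ ≲ ‖Q_kY‖`

Cell `ym3-torus` ∕ fleet seat `ym-ust-19200-p1` (gen 3).  WHY.  In the `ℓ²` route to the uniqueness clause of [Balaban1985Variational] Prop. 7
(this seat's `Prop7UniquenessReduction`, p504929) the linear term `Lin_U(Y)` of the action expansion at a critical `U` is killed on TANGENT
directions of the averaging fibre and survives only on the defect `Y − Y_tan`, which must be small in `ℓ¹` — quadratically in `Y` — against the
sup bound `‖D^*_UF_U‖_∞ < ε₀L^{−3(K−n)}` of the divergence clause of (6).  For the main term of the linearised averaging, `Q_k = bondAvgIter k`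
([Balaban1984PropagatorsI] (1.18)), the defect is `H(Q_kY)` with the `k`-uniform right inverse `H` of `…LineAvgRightInverse` (p503703); this file
records the resulting projection with its three bounds ([Balaban1985Variational] Sect. C (47)–(48): «A = A′ − HD(A′)» with `|HX| ≤ B₀|X|`).

WHAT IS PROVED (sorry-free, no definition).  **`exists_ker_bondAvgIter_near`**: for every real bond field `Y` on the finest torus and `k` in the
standing range there is `Y₀` with `Q_kY₀ = 0`, `max|Y − Y₀| ≤ 3·max|Q_kY|`, `Σ|Y − Y₀| ≤ 6L^{kd}Σ|Q_kY|`, `Σ(Y − Y₀)² ≤ 18L^{kd}Σ(Q_kY)²`, the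
assignment `Y ↦ Y₀` being LINEAR (`Y₀ = Y − H(Q_kY)`); **`exists_ker_bondAvgIter_near_T3`** — the d = 3 carrier (`Site (F.P K) 0`, `k = K − n`,
constants `3`, `6L^{3(K−n)}`, `18L^{3(K−n)}`, uniform in `m`, `n`, `K`).  Nothing of Bałaban's is asserted.

References: T. Bałaban, CMP 102 (1985) 277–309 [Balaban1985Variational] ((45)–(48) p.285); CMP 95 (1984) 17–40 [Balaban1984PropagatorsI] ((1.18) p.20).
-/

noncomputable section

open scoped BigOperators

namespace Summit.QuantumFields.YangMills.Theorems.Prop7LineAvgRightInverse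

open Literature.MathematicalPhysics.QuantumFieldTheory.Balaban1983to89
open Finset LatticeFieldCalculus
open Literature.MathematicalPhysics.QuantumFieldTheory.BalabanImbrieJaffe1984to88.BIJ85AxialPropagator411 (bondAvgIter_add bondAvgIter_smul)

variable {P : Params} {k : ℕ}

/-- **THE SECANT–TANGENT PROJECTION FOR `Q_k`**: every real bond field `Y` on the finest torus has a LINEAR kernel approximant `Y₀ = Y − H(Q_kY)`,
`Q_kY₀ = 0`, within `3·max|Q_kY|` of `Y` bondwise, `6L^{kd}Σ|Q_kY|` in `ℓ¹` and `18L^{kd}Σ(Q_kY)²` in `ℓ²` — constants independent of `k` and of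
the volume. [cite: Balaban1985Variational, (47)-(48) p.285] -/
theorem exists_ker_bondAvgIter_near (hk : k ≤ P.m + P.K) :
    ∃ Pr : (PBond P 0 → ℝ) →ₗ[ℝ] (PBond P 0 → ℝ), ∀ Y : VecField P 0 ℝ,
      bondAvgIter k (Pr Y) = 0 ∧
      (∀ B : ℝ, (∀ c : PBond P k, |bondAvgIter k Y c| ≤ B) → ∀ b : PBond P 0, |Y b - Pr Y b| ≤ 3 * B) ∧
      (∑ b : PBond P 0, |Y b - Pr Y b| ≤ 6 * ((P.L : ℝ) ^ k) ^ P.d * ∑ c : PBond P k, |bondAvgIter k Y c|) ∧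
      (∑ b : PBond P 0, (Y b - Pr Y b) ^ 2 ≤ 18 * ((P.L : ℝ) ^ k) ^ P.d * ∑ c : PBond P k, (bondAvgIter k Y c) ^ 2) := by
  obtain ⟨H, hH⟩ := exists_rightInverse_bondAvgIter (P := P) hk
  -- `Q_k` as a linear map
  let Q : (PBond P 0 → ℝ) →ₗ[ℝ] (PBond P k → ℝ) :=
    { toFun := fun Y => bondAvgIter k Y
      map_add' := fun Y Y' => bondAvgIter_add k Y Y'
      map_smul' := fun a Y => bondAvgIter_smul k a Y }
  let Pr : (PBond P 0 → ℝ) →ₗ[ℝ] (PBond P 0 → ℝ) := LinearMap.id - H ∘ₗ Q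
  refine ⟨Pr, fun Y => ?_⟩
  have hPr : Pr Y = Y - H (bondAvgIter k Y) := rfl
  have hdiff : ∀ b : PBond P 0, Y b - Pr Y b = H (bondAvgIter k Y) b := fun b => by
    rw [hPr]; simp
  obtain ⟨h1, h2, h3, h4⟩ := hH (bondAvgIter k Y)
  refine ⟨?_, fun B hB b => ?_, ?_, ?_⟩
  · rw [hPr]
    have hsub : Y - H (bondAvgIter k Y) = Y + (-1 : ℝ) • H (bondAvgIter k Y) := by
      funext b; simp [sub_eq_add_neg]
    rw [hsub, bondAvgIter_add, bondAvgIter_smul, h1]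
    funext c; simp
  · rw [hdiff]; exact h2 B hB b
  · simp only [hdiff]; exact h3
  · simp only [hdiff]; exact h4

/-- **AT THE d = 3 CARRIER** (`Site (F.P K) 0`, `k = K − n`): the linear kernel approximant of `Q_{K−n}` with `max|Y − Y₀| ≤ 3max|Q_{K−n}Y|`,
`Σ|Y − Y₀| ≤ 6L^{3(K−n)}Σ|Q_{K−n}Y|`, `Σ(Y − Y₀)² ≤ 18L^{3(K−n)}Σ(Q_{K−n}Y)²`, uniformly in `m`, `n`, `K`.
[cite: Balaban1985Variational, (47)-(48) p.285] -/
theorem exists_ker_bondAvgIter_near_T3 (F : T3ContinuumYM3Torus.T3Family) (n K : ℕ) :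
    ∃ Pr : (PBond (F.P K) 0 → ℝ) →ₗ[ℝ] (PBond (F.P K) 0 → ℝ), ∀ Y : VecField (F.P K) 0 ℝ,
      bondAvgIter (K - n) (Pr Y) = 0 ∧
      (∀ B : ℝ, (∀ c : PBond (F.P K) (K - n), |bondAvgIter (K - n) Y c| ≤ B) → ∀ b : PBond (F.P K) 0, |Y b - Pr Y b| ≤ 3 * B) ∧
      (∑ b : PBond (F.P K) 0, |Y b - Pr Y b| ≤ 6 * ((F.L : ℝ) ^ (K - n)) ^ 3 * ∑ c : PBond (F.P K) (K - n), |bondAvgIter (K - n) Y c|) ∧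
      (∑ b : PBond (F.P K) 0, (Y b - Pr Y b) ^ 2
        ≤ 18 * ((F.L : ℝ) ^ (K - n)) ^ 3 * ∑ c : PBond (F.P K) (K - n), (bondAvgIter (K - n) Y c) ^ 2) :=
  exists_ker_bondAvgIter_near (P := F.P K) (show K - n ≤ F.m + K by omega)

end Summit.QuantumFields.YangMills.Theorems.Prop7LineAvgRightInverse

end
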